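import Mathlib
import Summits.Ventures.HodgeRepro2.T6NAut
import Summits.Ventures.HodgeRepro2.T6N1Main

/-!
# T6N1NAut — sub-step N1 over the M2 composition carrier (TARGET-T6 §9.3; owner t6-p1)

The one-line wrapper of `N1Main.N1_main` in the shape the lead's `T6N.lean` v2 consumes: over
`(P : NDatum F) (M : NAut F P)`, with the N1 datum `M.d1` and the pairing `M.pairing c`
(`NAut.pairing_eq : M.pairing c = M.d1.pairing c := rfl`). The four displays of `T6N1Hyp` are its binders
(the N1 binders of `periodInputN_of_published`) — the two Liu displays in their v2 form
(`Liu2021_Prop4_13_vertexLiftA₂` / `…B₂`, the re-issue with the glyph restorations declared; definitionally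
the v1 Props consumed by `N1Main.N1_main`). §8(d): uses an L-value-free non-vanishing device: NO.
-/

namespace Summit.Ventures.HodgeRepro2.T6.N1NAut

variable {K : Type*} [Field K] [NumberField K] {F : FaceSetting K}

/-- SUB-STEP N1 over the composition carrier (TARGET-T6 §9.3): for every admissible choice `c`,
`M.pairing c ≠ 0 → P.I P.τ₁ c ≠ 0` — `T5Assembly.AssemblyCore.N1` with `S := K →+* ℂ`, `Datum := Unit`,
`Choice := P.Choice`, `K := ℂ`, `AdmChoice := P.AdmChoice`, `I := P.I`, `P := M.pairing`, `τ₁ := P.τ₁`.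
Consumes the four displays of `T6N1Hyp` by name (the Liu pair in v2 form), at `M.d1`. -/
theorem N1_main (P : NDatum F) (M : NAut F P) (hH : Hyp.Voisin2002_7_3_2 M.d1)
    (hL : Hyp.Voisin2002_Lemma5_4_petersson M.d1) (hA : Hyp.Liu2021_Prop4_13_vertexLiftA₂ M.d1)
    (hB : Hyp.Liu2021_Prop4_13_vertexLiftB₂ M.d1) :
    ∀ c : P.Choice, P.AdmChoice c → M.pairing c ≠ 0 → P.I P.τ₁ c ≠ 0 :=
  fun c hc hp => N1Main.N1_main M.d1 hH hL hA hB c hc (by rwa [M.pairing_eq] at hp)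

end Summit.Ventures.HodgeRepro2.T6.N1NAut
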